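import Summits.CriticalPhenomena.PercolationContinuityZ3.Theorems.Transplant.PlanarCellsSep
import Summits.CriticalPhenomena.PercolationContinuityZ3.Theorems.Transplant.PlanarCellsFaces
import Summits.CriticalPhenomena.PercolationContinuityZ3.Theorems.Transplant.KNCellsExit
import Summits.CriticalPhenomena.PercolationContinuityZ3.Theorems.Transplant.KNCellsStepsDefs
import Summits.CriticalPhenomena.PercolationContinuityZ3.Theorems.Transplant.KNLevelsStepIII
import Summits.CriticalPhenomena.PercolationContinuityZ3.Theorems.Transplant.BoxProdZ2SeedGeom
import HarnessLib

/-!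
# The `X □ ℤ²` INSTANCE of the anchored cell geometry (p2-g2's `KNCells.CellGeom`, F8 / BLUEPRINT-I-PHI §3 Φ11, §5 frames): cells
# `B_X(anchor, ·) × (planar KN cell)`, with the structural facts `RunGeom`, `SepGeom`, `ExitGeom`

builds on p205010 (kernel theorem, internal audit signed; external expert review pending) — nothing in this file uses p205010.
Lane `prim-bschramm`, seat `prim-bschramm-p3` (claimed 09:2xZ, cc lead/p2-g2); helper file (`--supports stmt-CriticalPhenomena-4575 --as helper`).

Anchors are fibre vertices `A = W` (F8-DESIGN §1, §3: entry-centred cells).  With ONE fibre scale `R` the boxes are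
`M a v = B_X(a, R) × M_v`, `Q a v = B_X(a, 2R) × Q_v`, `Cell a v = B_X(a, 3R) × Cell_v`, and `Btw / Efar / Stub / Zone` anchored at the
DEPARTURE anchor `a'` with fibre radius `R`: `B_X(a', R) × (planar box)`; `anchSet a v = B_X(a, R)` (the departure anchor is a fibre
coordinate of a vertex of `M a v`), so that `B_X(a', R) ⊆ B_X(a, 2R) ⊆ B_X(a, 3R)` gives the anchored containments of `SepGeom`; the root is
`(a₀, 0)`; the planar column of `x` is `{y | y.2 = cen x}`.  The re-centring rule is a PARAMETER `anchor` with `anchor a v P ∈ B_X(a, R)`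
(p2-g2's rule — fibre coordinate of the least-rank vertex of `M a v` joined to the root in the seen pattern — is one admissible choice; the
geometry below holds for every admissible rule).
* `cellGeom X C R a₀ anchor hanch : CellGeom (W × Site 2) W`;
* `runGeom` (every vertex of `Q`, `Btw`, `Stub` has a neighbour inside: a planar step), `sepGeom` (the sixteen separation / containment /
  column facts, from `PlanarCellsDefs/Sep` and ball inclusions), `exitGeom` (`M ⊆ Q`, `Cell ∩ Q' = ∅`, `Zone ∩ Q' = ∅`, local finiteness);
* `faceData` (`Face a v δ j = B_X(a, R) × F^j_{v,x}`, `Hfull a v δ = B_X(a, R) × H_{v,x}`) with `stepsGeom : StepsGeom Γ faceData`;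
* the **entry anchor** `entryAnchor` (p2-g2, F8-DESIGN §3: fibre coordinate of the least-`KNLevels.rank` vertex of `M a v` joined to the root
  by the open edges seen, default `a`), admissible (`entryAnchor_mem`), and the resulting geometry `entryCellGeom`.

[cite: KozmaNitzan2024, §4 pp. 25–26 (Q_v, M_v, E_{v,x}, H^j_{v,x}) — the ℤ^d model]
-/

noncomputable section

open scoped Classical

namespace Summit.CriticalPhenomena.PercolationContinuityZ3.Theorems

namespace Transplant

namespace BoxProdZ2

open Literature.Probability.Percolation Literature.Probability.LatticeModels SimpleGraph GadgetSystem Contour KNCells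
open Literature.Probability.Percolation.KozmaNitzan.Cells (oth oth_ne sgOf sgOf_sign stepVec_apply_fst stepVec_apply_oth eq_oth_of_ne)
open Literature.Barriers.CriticalPhenomena (graphBall graphBall_finite mem_graphBall_self graphBall_mono)

variable {W : Type} (X : SimpleGraph W) [X.LocallyFinite]

/-- **The anchored cell geometry of `X □ ℤ²`** with planar cells `C`, fibre scale `R`, root anchor `a₀` and an admissible re-centring rule.
[cite: KozmaNitzan2024, §4 pp. 25–26] -/
def cellGeom (C : PCells) (R : ℕ) (a₀ : W) (anchor : W → Site 2 → Finset (Sym2 (W × Site 2)) → W)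
    (hanch : ∀ a v P, anchor a v P ∈ ballFin X a R) : CellGeom (W × Site 2) W where
  K := C.K
  root := (a₀, 0)
  a₀ := a₀
  Q := fun a v => ballFin X a (2 * R) ×ˢ C.Q v
  M := fun a v => ballFin X a R ×ˢ C.M v
  Cell := fun a v => ballFin X a (3 * R) ×ˢ C.Cell v
  Btw := fun a v δ => ballFin X a R ×ˢ C.Btw v δ
  Efar := fun a v δ => ballFin X a R ×ˢ C.Efar v δ
  Stub := fun a v δ j => ballFin X a R ×ˢ C.Stub v δ j
  Zone := fun a v δ => ballFin X a R ×ˢ C.Zone v δ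
  col := fun x => {y | y.2 = C.cen x}
  anchor := anchor
  anchSet := fun a _ => ballFin X a R
  anchor_mem := fun a v P => hanch a v P
  stub_mono := fun _ v δ _ _ h => Finset.product_subset_product le_rfl (C.Stub_mono v δ h)
  hK := by have := C.hK; omega

variable (C : PCells) (R : ℕ) (a₀ : W) (anchor : W → Site 2 → Finset (Sym2 (W × Site 2)) → W)
  (hanch : ∀ a v P, anchor a v P ∈ ballFin X a R)

/-! ## Fibre ball inclusions -/

/-- `B(a', R) ⊆ B(a, R + R')`-type inclusion for an admissible anchor `a' ∈ B(a, R')`. [folklore] -/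
theorem ballFin_subset_of_mem {a a' : W} {R' S T : ℕ} (ha' : a' ∈ ballFin X a R') (hST : R' + S ≤ T) : ballFin X a' S ⊆ ballFin X a T := by
  intro w hw
  rw [mem_ballFin] at ha' hw ⊢
  exact graphBall_mono X a hST (mem_graphBall_add X ha' hw)

/-- Product sets with disjoint planar parts are disjoint. [folklore] -/
theorem disjoint_product_of_right {B B' : Finset W} {P P' : Finset (Site 2)} (h : Disjoint P P') : Disjoint (B ×ˢ P) (B' ×ˢ P') := by
  rw [Finset.disjoint_left]
  intro u hu hu'
  exact Finset.disjoint_left.1 h (Finset.mem_product.1 hu).2 (Finset.mem_product.1 hu').2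

/-- A product set is covered by the union of two product sets when the fibre part fits in both and the planar part is covered. [folklore] -/
theorem product_subset_union [DecidableEq W] {B B₁ B₂ : Finset W} {P P₁ P₂ : Finset (Site 2)} (h₁ : B ⊆ B₁) (h₂ : B ⊆ B₂) (hP : P ⊆ P₁ ∪ P₂) :
    B ×ˢ P ⊆ B₁ ×ˢ P₁ ∪ B₂ ×ˢ P₂ := by
  intro u hu
  obtain ⟨hw, ht⟩ := Finset.mem_product.1 hu
  rcases Finset.mem_union.1 (hP ht) with h | h
  · exact Finset.mem_union.2 (Or.inl (Finset.mem_product.2 ⟨h₁ hw, h⟩))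
  · exact Finset.mem_union.2 (Or.inr (Finset.mem_product.2 ⟨h₂ hw, h⟩))

omit [X.LocallyFinite] in
/-- Self-adjacency of a product set from planar self-adjacency. [folklore] -/
theorem exists_adj_product {B : Finset W} {P : Finset (Site 2)} (hP : ∀ t ∈ P, ∃ t' ∈ P, (zdGraph 2).Adj t t') {y : W × Site 2}
    (hy : y ∈ B ×ˢ P) : ∃ z ∈ B ×ˢ P, (X □ zdGraph 2).Adj y z := by
  obtain ⟨hw, ht⟩ := Finset.mem_product.1 hy
  obtain ⟨t', ht', hadj⟩ := hP y.2 ht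
  exact ⟨(y.1, t'), Finset.mem_product.2 ⟨hw, ht'⟩, (boxProd_adj).2 (Or.inr ⟨hadj, rfl⟩)⟩

/-! ## The structural facts -/

/-- **`RunGeom`** for the `X □ ℤ²` cells: planar steps inside the boxes. [folklore] -/
theorem runGeom : RunGeom (X □ zdGraph 2) (cellGeom X C R a₀ anchor hanch) where
  adjQ _ v _ hy := exists_adj_product X (fun _ ht => C.exists_adj_of_mem_Q v ht) hy
  adjBtw _ v δ _ hy := exists_adj_product X (fun _ ht => C.exists_adj_of_mem_Btw v δ ht) hy
  adjStub _ v δ j _ _ hy := exists_adj_product X (fun _ ht => C.exists_adj_of_mem_Stub v δ j ht) hy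

/-- **`SepGeom`** for the `X □ ℤ²` cells: the planar separation facts of `PlanarCellsSep` with the fibre balls as passengers, and the anchored
containments through `B(a', R) ⊆ B(a, 2R) ⊆ B(a, 3R)` for `a' ∈ B(a, R)`. [cite: KozmaNitzan2024, §4 pp. 25–26] -/
theorem sepGeom [DecidableEq W] : SepGeom (X □ zdGraph 2) (cellGeom X C R a₀ anchor hanch) where
  anch_refl a v := by change a ∈ ballFin X a R; rw [mem_ballFin]; exact mem_graphBall_self X a R
  root_mem := by
    change (a₀, (0 : Site 2)) ∈ ballFin X a₀ (2 * R) ×ˢ C.Q 0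
    exact Finset.mem_product.2 ⟨(mem_ballFin X).2 (mem_graphBall_self X a₀ _), C.zero_mem_Q_zero⟩
  Q_subset_Cell a v := Finset.product_subset_product (ballFin_mono X a (by omega)) (C.Q_subset_Cell v)
  Btw_subset_Cells a a' v δ ha' := by
    change ballFin X a' R ×ˢ C.Btw v δ ⊆ ballFin X a (3 * R) ×ˢ C.Cell v ∪ ballFin X a' (3 * R) ×ˢ C.Cell (v + stepVec δ)
    exact product_subset_union (ballFin_subset_of_mem X ha' (by omega)) (ballFin_mono X a' (by omega)) (C.Btw_subset_Cells v δ)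
  Stub_subset_Q_union_Btw a a' v δ j ha' hj := by
    change ballFin X a' R ×ˢ C.Stub v δ j ⊆ ballFin X a (2 * R) ×ˢ C.Q v ∪ ballFin X a' R ×ˢ C.Btw v δ
    exact product_subset_union (ballFin_subset_of_mem X ha' (by omega)) le_rfl
      (C.Stub_subset_Q_union_Btw v δ (by change j + 1 ≤ C.K at hj; omega))
  Stub_subset_Cell_union_Zone a a' v δ j ha' hj := by
    change ballFin X a' R ×ˢ C.Stub v δ j ⊆ ballFin X a (3 * R) ×ˢ C.Cell v ∪ ballFin X a' R ×ˢ C.Zone v δ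
    exact product_subset_union (ballFin_subset_of_mem X ha' (by omega)) le_rfl
      (C.Stub_subset_Cell_union_Zone v δ (by change j + 1 ≤ C.K at hj; omega))
  Efar_subset_Btw_union_Q a v δ := by
    change ballFin X a R ×ˢ C.Efar v δ ⊆ ballFin X a R ×ˢ C.Btw v δ ∪ ballFin X a (2 * R) ×ˢ C.Q (v + stepVec δ)
    exact product_subset_union le_rfl (ballFin_mono X a (by omega)) (C.Efar_subset_Btw_union_Q v δ)
  Ewv_disjoint_Efar a a' w δw du hdu := by
    change Disjoint (ballFin X a R ×ˢ C.Btw w δw ∪ ballFin X a (2 * R) ×ˢ C.Q (w + stepVec δw)) (ballFin X a' R ×ˢ C.Efar (w + stepVec δw) du)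
    have h := C.Ewv_disjoint_Efar w hdu
    rw [PCells.Ewv, Finset.disjoint_union_left] at h
    rw [Finset.disjoint_union_left]
    exact ⟨disjoint_product_of_right h.1, disjoint_product_of_right h.2⟩
  Q_disjoint_Q a a' u x hux := disjoint_product_of_right (C.Q_disjoint_Q hux)
  Q_disjoint_Btw a a' x v δ := disjoint_product_of_right (C.Q_disjoint_Btw x v δ)
  Btw_disjoint_Btw a a' v δ v' δ' h1 h2 := disjoint_product_of_right (C.Btw_disjoint_Btw h1 h2)
  Q_disjoint_Efar a a' v δ := disjoint_product_of_right (C.Q_disjoint_Efar v δ)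
  Btw_disjoint_Efar a a' v δ δ' h := disjoint_product_of_right (C.Btw_disjoint_Efar v h)
  col_Q a x := ⟨(a, C.cen x), Finset.mem_product.2 ⟨(mem_ballFin X).2 (mem_graphBall_self X a _), C.cen_mem_Q x⟩, rfl⟩
  col_Cell a u x hux y hy hcol := by
    change y.2 = C.cen x at hcol
    exact C.cen_not_mem_Cell hux (hcol ▸ (Finset.mem_product.1 hy).2)
  col_Zone a u δ x y hy hcol := by
    change y.2 = C.cen x at hcol
    exact C.cen_not_mem_Zone u δ x (hcol ▸ (Finset.mem_product.1 hy).2)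

/-- A crude planar bound: a point of `E_{w,δ} = Btw ∪ Q_{w+δ}` is within `35 r` of the centre of `w + δ` in each coordinate. [folklore] -/
theorem sub_cen_le_of_mem_Ewv {w : Site 2} {δ : MDir} {t : Site 2} (ht : t ∈ C.Ewv w δ) (i : Fin 2) :
    |t i - C.cen (w + stepVec δ) i| ≤ 35 * C.r := by
  rw [PCells.Ewv, Finset.mem_union] at ht
  have hf := C.cen_add_stepVec_fst w δ
  have ho := C.cen_add_stepVec_oth w δ
  rw [abs_le]
  rcases ht with ht | ht
  · rw [PCells.Btw, PCells.mem_psBox_iff] at ht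
    obtain ⟨⟨h1, h2⟩, h3, h4⟩ := ht
    rcases eq_or_ne i δ.1 with rfl | hi
    · rw [hf]; rcases sgOf_sign δ with hs | hs <;> rw [hs] at h1 h2 ⊢ <;> constructor <;> nlinarith
    · rw [eq_oth_of_ne hi, ho]; constructor <;> linarith
  · rw [PCells.Q, C.mem_sq_iff] at ht
    have := ht i; push_cast at this; constructor <;> linarith

/-- **`ExitGeom`** for the `X □ ℤ²` cells. [cite: KozmaNitzan2024, §4 pp. 26–27] -/
theorem exitGeom [DecidableEq W] : ExitGeom (X □ zdGraph 2) (cellGeom X C R a₀ anchor hanch) where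
  M_subset_Q a v := Finset.product_subset_product (ballFin_mono X a (by omega)) (C.M_subset_Q v)
  Cell_disjoint_Q a a' u x hux := disjoint_product_of_right (C.Cell_disjoint_Q hux)
  Zone_disjoint_Q a a' u δ x := disjoint_product_of_right (C.Zone_disjoint_Q u δ x)
  locFin y := by
    -- the macro-vertices whose incoming `E_{w,v}` has a vertex adjacent to `y` have bounded planar coordinates
    set B : Site 2 := fun i => |y.2 i| + 35 * C.r + 1 with hB
    refine (Finset.Icc (-B) B).finite_toSet.subset ?_
    rintro v ⟨a, w, δ, rfl, b, hb, hadj⟩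
    change b ∈ ballFin X a R ×ˢ C.Btw w δ ∪ ballFin X a (2 * R) ×ˢ C.Q (w + stepVec δ) at hb
    have hb2 : b.2 ∈ C.Ewv w δ := by
      rw [PCells.Ewv, Finset.mem_union]
      rcases Finset.mem_union.1 hb with h | h
      · exact Or.inl (Finset.mem_product.1 h).2
      · exact Or.inr (Finset.mem_product.1 h).2
    -- `b.2` is within `1` of `y.2` in each coordinate
    have hnear : ∀ i, |b.2 i - y.2 i| ≤ 1 := by
      intro i
      rcases (boxProd_adj).1 hadj with ⟨-, h2⟩ | ⟨h2, -⟩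
      · rw [h2, sub_self, abs_zero]; exact zero_le_one
      · exact abs_sub_comm (b.2 i) (y.2 i) ▸ DCT16.abs_sub_le_one_of_adj h2 i
    rw [Finset.coe_Icc, Set.mem_Icc]
    have hr : (1 : ℤ) ≤ C.r := by exact_mod_cast C.one_le_r
    have key : ∀ i, |(w + stepVec δ) i| ≤ B i := by
      intro i
      have h1 := sub_cen_le_of_mem_Ewv C hb2 i
      have h2 := hnear i
      rw [abs_le] at h1 h2 ⊢
      simp only [PCells.cen_apply] at h1
      simp only [hB]
      have hy := abs_nonneg (y.2 i)
      have hy' := le_abs_self (y.2 i)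
      have hy'' := neg_abs_le (y.2 i)
      constructor <;> nlinarith
    exact ⟨fun i => (abs_le.1 (key i)).1, fun i => (abs_le.1 (key i)).2⟩

/-! ## The faces and the corridor (Step IV data) -/

/-- **The faces and full corridors of the `X □ ℤ²` cells**: fibre ball of radius `R` at the (departure) anchor times the planar face /
corridor. [cite: KozmaNitzan2024, §4 p. 26 (H_{v,x}), p. 30 (F^j_{v,x})] -/
def faceData : FaceData (W × Site 2) W where
  Face := fun a v δ j => ballFin X a R ×ˢ C.Face v δ j
  Hfull := fun a v δ => ballFin X a R ×ˢ C.Hfull v δ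

/-- **`StepsGeom`** for the `X □ ℤ²` cells. [cite: KozmaNitzan2024, §4 pp. 26, 30] -/
theorem stepsGeom [DecidableEq W] : StepsGeom (cellGeom X C R a₀ anchor hanch) (faceData X C R) where
  Face_subset_Stub a v δ j := Finset.product_subset_product le_rfl (C.Face_subset_Stub v δ j)
  Stub_subset_Hfull a v δ j hj := Finset.product_subset_product le_rfl (C.Stub_subset_Hfull v δ hj)
  Hfull_subset a a' v δ ha' := by
    change ballFin X a' R ×ˢ C.Hfull v δ ⊆ ballFin X a (2 * R) ×ˢ C.Q v ∪ ballFin X a' R ×ˢ C.Efar v δ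
    exact product_subset_union (ballFin_subset_of_mem X ha' (by omega)) le_rfl (C.Hfull_subset_Q_union_Efar v δ)
  M_tgt_subset_Efar a v δ := Finset.product_subset_product le_rfl (C.M_add_stepVec_subset_Efar v δ)

/-! ## An admissible re-centring rule: the entry anchor -/

/-- **The entry anchor** (F8-DESIGN §3): the fibre coordinate of the least-rank vertex of `M a v` (rank `KNLevels.rank (M a v)`) joined to
the root by the open edges seen, and `a` itself if there is none. [cite: KozmaNitzan2024, §4 p. 27 (E_{i+1})] -/
def entryAnchor [DecidableEq W] (root : W × Site 2) (a : W) (v : Site 2) (P : Finset (Sym2 (W × Site 2))) : W :=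
  if h : ((ballFin X a R ×ˢ C.M v).filter fun y =>
      (SimpleGraph.fromEdgeSet (↑P : Set (Sym2 (W × Site 2)))).Reachable root y).Nonempty
  then (Classical.choose (Finset.exists_min_image _ (KNLevels.rank (ballFin X a R ×ˢ C.M v)) h)).1 else a

/-- The entry anchor is admissible: it lies in `B_X(a, R)`. [folklore] -/
theorem entryAnchor_mem [DecidableEq W] (root : W × Site 2) (a : W) (v : Site 2) (P : Finset (Sym2 (W × Site 2))) :
    entryAnchor X C R root a v P ∈ ballFin X a R := by
  unfold entryAnchor
  split_ifs with h
  · have hmem := (Classical.choose_spec (Finset.exists_min_image _ (KNLevels.rank (ballFin X a R ×ˢ C.M v)) h)).1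
    exact (Finset.mem_product.1 (Finset.mem_filter.1 hmem).1).1
  · exact (mem_ballFin X).2 (mem_graphBall_self X a R)

/-- **The `X □ ℤ²` cell geometry with the entry-anchor rule** (root `(a₀, 0)`). [cite: KozmaNitzan2024, §4 pp. 25–27] -/
def entryCellGeom [DecidableEq W] : CellGeom (W × Site 2) W :=
  cellGeom X C R a₀ (entryAnchor X C R (a₀, 0)) (entryAnchor_mem X C R (a₀, 0))

end BoxProdZ2

end Transplant

end Summit.CriticalPhenomena.PercolationContinuityZ3.Theorems

end
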